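import Summits.PneNP.PneNP.Theorems.ChebyshevTracialDesignLevelDifference
import HarnessLib

/-!
# Cell pnp-psdrank, route `ChebyshevTracialDesign`: tight dominance — every level's bi-mode coefficient is controlled by
# the tight one

Harmonic backbone of the crux `TracialDecayExp20` (stmt-PneNP-19878), brick 11. By brick 10 (`…LevelDifference`) the coefficient
with which the Johnson layer `2κ` of the `(2l+1)`-cuts enters the level class with `e₀ = l − m` inner edges (`c = 2m+1` crossing
edges; `m = 0` is the TIGHT level) is the `κ`-th difference
`σ̃_{2κ}(e₀) = Σ_{e'} (−1)^{κ−(e₀−e')} C(κ, e₀−e')·T(N−2κ; 2(l−κ)+1−2e', e')` of the reduced level law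
`T(N'; c', e') = C(N', c'+e')·C(c'+e', e')·2^{c'}` (`N = n/2`). Here it is bounded against the tight coefficient
`σ̃_{2κ}(l) = T(N−2κ; 1, l−κ)`:

  `|σ̃_{2κ}(l−m)| · T(N; 1, l) ≤ (1 + ρ)^κ · σ̃_{2κ}(l) · T(N; 2m+1, l−m)`,  `ρ = 2m(2m+1) / (4(l−m+1)(N−l−m))`   (`bimodeCoeff_abs_mul_le`)

for `κ ≤ l`, `m ≤ l`, `2l+1 ≤ N` — i.e. the normalised level profile `s_κ(c) = σ̃_{2κ}(c)/#(level class c)` satisfies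
`|s_κ(c)| ≤ (1+ρ_c)^κ · s_κ(1)`: the TIGHT level dominates every level on every even layer, up to the factor `(1+ρ_c)^κ`
(`ρ_c ≈ c²/(l(N−l))`, so `(1+ρ_c)^κ ≤ e^{O(1)}` for the design levels `c ≤ 4√n+3`, `κ ≤ l`, balanced `t`). Exact check: the
bound holds in all 8399 cases `n ≤ 60` (seat work/num/nabla.py); the sharper `|s_κ(c)| ≤ s_κ(1)` holds there except at `c = t = n/2`.
Mechanism (elementary, no spectral theory): the one-step ratio of the level law `T(N; c+2, e)·(c+1)(c+2) = 4(e+1)(N−c−e−1)·T(N; c, e+1)`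
(`levelLaw_step`); going DOWN from the tight top the reduced law (`2κ` fewer edges) decays at least as fast as the unreduced one
(`reduced_mul_le`), and going UP `k ≤ m` steps to the level `c = 2m+1` costs at most `ρ^k` (`levelLaw_up_le`); the triangle
inequality over the `≤ κ+1` terms of the difference and `Σ_i C(κ,i)ρ^{κ−i} = (1+ρ)^κ` finish. The squared form
`bimodeCoeff_sq_mul_le` is what the spectral conversion (brick 12, `…LevelAttenuation`: `λ_{2κ}(c) ≤ λ₀(c)·(1+ρ_c)^{2κ}·Π_{i<κ}(2i+1)/(n−2i)`)
consumes. [cite: Rothvoss2017, §2 (PDF p. 6)] [cite: GodsilMeagher2015, §15.2 (perfect matching scheme)]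
Stature: support/instrument. WHAT THIS IS NOT: not yet an eigenvalue statement, nothing on psd rank, no P-vs-NP content.
Supports crux stmt-PneNP-19878.
-/

set_option linter.dupNamespace false -- `Summit.PneNP.PneNP.…`: summit = sub-problem (D-0017)

noncomputable section

namespace Summit.PneNP.PneNP.Theorems.ChebyshevTracialDesignLevelDominance

open Finset

/-! ### §1 The one-step ratio of the level law -/

/-- Two binomial bookkeeping identities: `C(c+e+2, e)·(c+1)(c+2) = C(c+e+1, e+1)·(e+1)·(c+e+2)`. [folklore] -/
theorem choose_mul_succ_mul_succ (c e : ℕ) :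
    (c + e + 2).choose e * ((c + 1) * (c + 2)) = (c + e + 1).choose (e + 1) * (e + 1) * (c + e + 2) := by
  have h1 : (c + e + 2).choose (e + 1) * (e + 1) = (c + e + 2).choose e * (c + 2) := by
    have := Nat.choose_succ_right_eq (c + e + 2) e
    rwa [show c + e + 2 - e = c + 2 by omega] at this
  have h2 : (c + e + 2) * (c + e + 1).choose e = (c + e + 2).choose (e + 1) * (e + 1) :=
    Nat.add_one_mul_choose_eq (c + e + 1) e
  have h3 : (c + e + 1).choose (e + 1) * (e + 1) = (c + e + 1).choose e * (c + 1) := by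
    have := Nat.choose_succ_right_eq (c + e + 1) e
    rwa [show c + e + 1 - e = c + 1 by omega] at this
  calc (c + e + 2).choose e * ((c + 1) * (c + 2))
      = ((c + e + 2).choose e * (c + 2)) * (c + 1) := by ring
    _ = ((c + e + 2).choose (e + 1) * (e + 1)) * (c + 1) := by rw [h1]
    _ = ((c + e + 2) * (c + e + 1).choose e) * (c + 1) := by rw [h2]
    _ = (c + e + 2) * ((c + e + 1).choose e * (c + 1)) := by ring
    _ = (c + e + 2) * ((c + e + 1).choose (e + 1) * (e + 1)) := by rw [h3]
    _ = _ := by ring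

/-- **One step of the level law** `T(N; c, e) = C(N, c+e)·C(c+e, e)·2^c` (number of `(c+2e)`-subsets of a `2N`-set meeting a
fixed perfect matching in `c` crossing and `e` inner edges): trading one inner edge for two crossing ones,
`T(N; c+2, e)·(c+1)(c+2) = 4(e+1)(N−c−e−1)·T(N; c, e+1)`. [folklore] -/
theorem levelLaw_step (N c e : ℕ) :
    N.choose (c + 2 + e) * (c + 2 + e).choose e * 2 ^ (c + 2) * ((c + 1) * (c + 2)) =
      4 * (e + 1) * (N - (c + e + 1)) * (N.choose (c + (e + 1)) * (c + (e + 1)).choose (e + 1) * 2 ^ c) := by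
  have h4 : N.choose (c + e + 2) * (c + e + 2) = N.choose (c + e + 1) * (N - (c + e + 1)) :=
    Nat.choose_succ_right_eq N (c + e + 1)
  have K := choose_mul_succ_mul_succ c e
  rw [show c + 2 + e = c + e + 2 by ring, show c + (e + 1) = c + e + 1 by ring]
  calc N.choose (c + e + 2) * (c + e + 2).choose e * 2 ^ (c + 2) * ((c + 1) * (c + 2))
      = N.choose (c + e + 2) * ((c + e + 2).choose e * ((c + 1) * (c + 2))) * 2 ^ (c + 2) := by ring
    _ = N.choose (c + e + 2) * ((c + e + 1).choose (e + 1) * (e + 1) * (c + e + 2)) * 2 ^ (c + 2) := by rw [K]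
    _ = (N.choose (c + e + 2) * (c + e + 2)) * (c + e + 1).choose (e + 1) * (e + 1) * 2 ^ (c + 2) := by ring
    _ = (N.choose (c + e + 1) * (N - (c + e + 1))) * (c + e + 1).choose (e + 1) * (e + 1) * 2 ^ (c + 2) := by rw [h4]
    _ = _ := by ring

/-! ### §2 Going down from the tight top: the reduced law decays at least as fast -/

/-- **Reduced versus unreduced down-steps.** For `κ ≤ l` and `j ≤ l − κ` (with `N' = N − 2κ`, `l' = l − κ`):
`T(N'; 2j+1, l'−j) · T(N; 1, l) ≤ T(N'; 1, l') · T(N; 2j+1, l−j)` — starting from the tight top, `j` steps down the reduced level law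
lose at least as much as `j` steps down the unreduced one (each step ratio `4ef/((c+1)(c+2))` has `e' ≤ e`, `f' ≤ f`). [folklore] -/
theorem reduced_mul_le (N l κ : ℕ) (hκl : κ ≤ l) : ∀ j : ℕ, j ≤ l - κ →
    (N - 2 * κ).choose (2 * j + 1 + (l - κ - j)) * (2 * j + 1 + (l - κ - j)).choose (l - κ - j) * 2 ^ (2 * j + 1) *
        (N.choose (1 + l) * (1 + l).choose l * 2 ^ 1) ≤
      (N - 2 * κ).choose (1 + (l - κ)) * (1 + (l - κ)).choose (l - κ) * 2 ^ 1 *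
        (N.choose (2 * j + 1 + (l - j)) * (2 * j + 1 + (l - j)).choose (l - j) * 2 ^ (2 * j + 1)) := by
  intro j
  induction j with
  | zero => intro _; simp
  | succ j ih =>
    intro hj
    have ih' := ih (by omega)
    -- one step down in both laws
    have hR := levelLaw_step (N - 2 * κ) (2 * j + 1) (l - κ - j - 1)
    have hU := levelLaw_step N (2 * j + 1) (l - j - 1)
    rw [show l - κ - j - 1 + 1 = l - κ - j by omega] at hR
    rw [show l - j - 1 + 1 = l - j by omega] at hU
    rw [show 2 * (j + 1) + 1 + (l - κ - (j + 1)) = 2 * j + 1 + 2 + (l - κ - j - 1) by omega,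
      show l - κ - (j + 1) = l - κ - j - 1 by omega, show 2 * (j + 1) + 1 = 2 * j + 1 + 2 by ring,
      show 2 * j + 1 + 2 + (l - (j + 1)) = 2 * j + 1 + 2 + (l - j - 1) by omega, show l - (j + 1) = l - j - 1 by omega]
    -- cancel the common positive factor `(2j+2)(2j+3)`
    have hpos : 0 < (2 * j + 1 + 1) * (2 * j + 1 + 2) := by positivity
    refine Nat.le_of_mul_le_mul_right ?_ hpos
    have hfac : 4 * (l - κ - j) * (N - 2 * κ - (2 * j + 1 + (l - κ - j - 1) + 1)) ≤
        4 * (l - j) * (N - (2 * j + 1 + (l - j - 1) + 1)) :=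
      Nat.mul_le_mul (Nat.mul_le_mul_left _ (by omega)) (by omega)
    calc (N - 2 * κ).choose (2 * j + 1 + 2 + (l - κ - j - 1)) * (2 * j + 1 + 2 + (l - κ - j - 1)).choose (l - κ - j - 1) *
          2 ^ (2 * j + 1 + 2) * (N.choose (1 + l) * (1 + l).choose l * 2 ^ 1) * ((2 * j + 1 + 1) * (2 * j + 1 + 2))
        = ((N - 2 * κ).choose (2 * j + 1 + 2 + (l - κ - j - 1)) * (2 * j + 1 + 2 + (l - κ - j - 1)).choose (l - κ - j - 1) *
          2 ^ (2 * j + 1 + 2) * ((2 * j + 1 + 1) * (2 * j + 1 + 2))) * (N.choose (1 + l) * (1 + l).choose l * 2 ^ 1) := by ring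
      _ = 4 * (l - κ - j) * (N - 2 * κ - (2 * j + 1 + (l - κ - j - 1) + 1)) *
          ((N - 2 * κ).choose (2 * j + 1 + (l - κ - j)) * (2 * j + 1 + (l - κ - j)).choose (l - κ - j) * 2 ^ (2 * j + 1) *
            (N.choose (1 + l) * (1 + l).choose l * 2 ^ 1)) := by rw [hR]; ring
      _ ≤ 4 * (l - κ - j) * (N - 2 * κ - (2 * j + 1 + (l - κ - j - 1) + 1)) *
          ((N - 2 * κ).choose (1 + (l - κ)) * (1 + (l - κ)).choose (l - κ) * 2 ^ 1 *
            (N.choose (2 * j + 1 + (l - j)) * (2 * j + 1 + (l - j)).choose (l - j) * 2 ^ (2 * j + 1))) :=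
          Nat.mul_le_mul_left _ ih'
      _ ≤ 4 * (l - j) * (N - (2 * j + 1 + (l - j - 1) + 1)) *
          ((N - 2 * κ).choose (1 + (l - κ)) * (1 + (l - κ)).choose (l - κ) * 2 ^ 1 *
            (N.choose (2 * j + 1 + (l - j)) * (2 * j + 1 + (l - j)).choose (l - j) * 2 ^ (2 * j + 1))) :=
          Nat.mul_le_mul_right _ hfac
      _ = (N - 2 * κ).choose (1 + (l - κ)) * (1 + (l - κ)).choose (l - κ) * 2 ^ 1 *
          (4 * (l - j) * (N - (2 * j + 1 + (l - j - 1) + 1)) *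
            (N.choose (2 * j + 1 + (l - j)) * (2 * j + 1 + (l - j)).choose (l - j) * 2 ^ (2 * j + 1))) := by ring
      _ = _ := by rw [← hU]; ring

/-! ### §3 Going up from the level `c = 2m+1`: each step costs at most `ρ` -/

/-- **Up-steps of the level law.** For `k ≤ m ≤ l` and `l + m < N`:
`T(N; 2(m−k)+1, l−m+k) · (4(l−m+1)(N−l−m))^k ≤ T(N; 2m+1, l−m) · (2m(2m+1))^k` — the `k` levels above `c = 2m+1` (fewer crossing,
more inner edges) are at most `ρ^k` times as populous, `ρ = 2m(2m+1)/(4(l−m+1)(N−l−m))`. [folklore] -/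
theorem levelLaw_up_le (N l m : ℕ) (hml : m ≤ l) : ∀ k : ℕ, k ≤ m →
    N.choose (2 * (m - k) + 1 + (l - m + k)) * (2 * (m - k) + 1 + (l - m + k)).choose (l - m + k) * 2 ^ (2 * (m - k) + 1) *
        (4 * (l - m + 1) * (N - l - m)) ^ k ≤
      N.choose (2 * m + 1 + (l - m)) * (2 * m + 1 + (l - m)).choose (l - m) * 2 ^ (2 * m + 1) * (2 * m * (2 * m + 1)) ^ k := by
  intro k
  induction k with
  | zero => intro _; simp
  | succ k ih =>
    intro hk
    have ih' := ih (by omega)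
    -- one step: from `k` levels up to `k+1` levels up
    have hS := levelLaw_step N (2 * (m - k - 1) + 1) (l - m + k)
    have e1 : 2 * (m - k - 1) + 1 + 2 + (l - m + k) = 2 * (m - k) + 1 + (l - m + k) := by omega
    have e2 : 2 * (m - k - 1) + 1 + 2 = 2 * (m - k) + 1 := by omega
    have e3 : 2 * (m - k - 1) + 1 + (l - m + k + 1) = 2 * (m - (k + 1)) + 1 + (l - m + (k + 1)) := by omega
    have e4 : l - m + k + 1 = l - m + (k + 1) := by omega
    have e5 : 2 * (m - k - 1) + 1 = 2 * (m - (k + 1)) + 1 := by omega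
    rw [e1, e2, e3, e4, e5] at hS
    -- the new term times `(c+1)(c+2)` is `4(e+1)f` times the old one; compare the factors with `num`, `den`
    have hstep : N.choose (2 * (m - (k + 1)) + 1 + (l - m + (k + 1))) *
          (2 * (m - (k + 1)) + 1 + (l - m + (k + 1))).choose (l - m + (k + 1)) * 2 ^ (2 * (m - (k + 1)) + 1) *
          (4 * (l - m + 1) * (N - l - m)) ≤
        N.choose (2 * (m - k) + 1 + (l - m + k)) * (2 * (m - k) + 1 + (l - m + k)).choose (l - m + k) * 2 ^ (2 * (m - k) + 1) *
          (2 * m * (2 * m + 1)) := by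
      have hcc : (2 * (m - (k + 1)) + 1 + 1) * (2 * (m - k) + 1) ≤ 2 * m * (2 * m + 1) :=
        Nat.mul_le_mul (by omega) (by omega)
      have hef : 4 * (l - m + 1) * (N - l - m) ≤ 4 * (l - m + (k + 1)) * (N - (2 * (m - (k + 1)) + 1 + (l - m + k) + 1)) :=
        Nat.mul_le_mul (Nat.mul_le_mul_left _ (by omega)) (by omega)
      calc N.choose (2 * (m - (k + 1)) + 1 + (l - m + (k + 1))) *
            (2 * (m - (k + 1)) + 1 + (l - m + (k + 1))).choose (l - m + (k + 1)) * 2 ^ (2 * (m - (k + 1)) + 1) *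
            (4 * (l - m + 1) * (N - l - m))
          ≤ N.choose (2 * (m - (k + 1)) + 1 + (l - m + (k + 1))) *
            (2 * (m - (k + 1)) + 1 + (l - m + (k + 1))).choose (l - m + (k + 1)) * 2 ^ (2 * (m - (k + 1)) + 1) *
            (4 * (l - m + (k + 1)) * (N - (2 * (m - (k + 1)) + 1 + (l - m + k) + 1))) := Nat.mul_le_mul_left _ hef
        _ = 4 * (l - m + (k + 1)) * (N - (2 * (m - (k + 1)) + 1 + (l - m + k) + 1)) *
            (N.choose (2 * (m - (k + 1)) + 1 + (l - m + (k + 1))) *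
              (2 * (m - (k + 1)) + 1 + (l - m + (k + 1))).choose (l - m + (k + 1)) * 2 ^ (2 * (m - (k + 1)) + 1)) := by ring
        _ = N.choose (2 * (m - k) + 1 + (l - m + k)) * (2 * (m - k) + 1 + (l - m + k)).choose (l - m + k) *
            2 ^ (2 * (m - k) + 1) * ((2 * (m - (k + 1)) + 1 + 1) * (2 * (m - k) + 1)) := hS.symm
        _ ≤ _ := Nat.mul_le_mul_left _ hcc
    calc N.choose (2 * (m - (k + 1)) + 1 + (l - m + (k + 1))) *
          (2 * (m - (k + 1)) + 1 + (l - m + (k + 1))).choose (l - m + (k + 1)) * 2 ^ (2 * (m - (k + 1)) + 1) *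
          (4 * (l - m + 1) * (N - l - m)) ^ (k + 1)
        = (N.choose (2 * (m - (k + 1)) + 1 + (l - m + (k + 1))) *
          (2 * (m - (k + 1)) + 1 + (l - m + (k + 1))).choose (l - m + (k + 1)) * 2 ^ (2 * (m - (k + 1)) + 1) *
          (4 * (l - m + 1) * (N - l - m))) * (4 * (l - m + 1) * (N - l - m)) ^ k := by ring
      _ ≤ (N.choose (2 * (m - k) + 1 + (l - m + k)) * (2 * (m - k) + 1 + (l - m + k)).choose (l - m + k) *
          2 ^ (2 * (m - k) + 1) * (2 * m * (2 * m + 1))) * (4 * (l - m + 1) * (N - l - m)) ^ k := Nat.mul_le_mul_right _ hstep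
      _ = (2 * m * (2 * m + 1)) * (N.choose (2 * (m - k) + 1 + (l - m + k)) *
          (2 * (m - k) + 1 + (l - m + k)).choose (l - m + k) * 2 ^ (2 * (m - k) + 1) * (4 * (l - m + 1) * (N - l - m)) ^ k) := by
          ring
      _ ≤ (2 * m * (2 * m + 1)) * (N.choose (2 * m + 1 + (l - m)) * (2 * m + 1 + (l - m)).choose (l - m) * 2 ^ (2 * m + 1) *
          (2 * m * (2 * m + 1)) ^ k) := Nat.mul_le_mul_left _ ih'
      _ = _ := by ring

/-! ### §4 Tight dominance -/

/-- **One term of the difference against the tight data.** For `κ ≤ l`, `m ≤ l`, `2l+1 ≤ N`, `e' ≤ l − κ`, `e' ≤ l − m` and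
`(l − m) − e' ≤ κ`: `T(N−2κ; 2(l−κ)+1−2e', e') · T(N; 1, l) ≤ ρ^{κ − ((l−m) − e')} · T(N−2κ; 1, l−κ) · T(N; 2m+1, l−m)` with
`ρ = 2m(2m+1)/(4(l−m+1)(N−l−m))`. [folklore] -/
theorem levelLaw_term_le (N l κ m e' : ℕ) (hκl : κ ≤ l) (hml : m ≤ l) (hlN : 2 * l + 1 ≤ N) (he'l : e' ≤ l - κ)
    (he'e : e' ≤ l - m) (hk : l - m - e' ≤ κ) :
    (((N - 2 * κ).choose (2 * (l - κ) + 1 - 2 * e' + e') * (2 * (l - κ) + 1 - 2 * e' + e').choose e' *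
          2 ^ (2 * (l - κ) + 1 - 2 * e') : ℕ) : ℝ) * ((N.choose (1 + l) * (1 + l).choose l * 2 ^ 1 : ℕ) : ℝ) ≤
      ((2 * m * (2 * m + 1) : ℝ) / (4 * (l - m + 1) * ((N - l - m : ℕ) : ℝ))) ^ (κ - (l - m - e')) *
        (((N - 2 * κ).choose (1 + (l - κ)) * (1 + (l - κ)).choose (l - κ) * 2 ^ 1 : ℕ) : ℝ) *
        ((N.choose (2 * m + 1 + (l - m)) * (2 * m + 1 + (l - m)).choose (l - m) * 2 ^ (2 * m + 1) : ℕ) : ℝ) := by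
  -- `j = l − κ − e'` down-steps in the reduced law, `k = κ − ((l−m) − e')` up-steps in the unreduced law, `j = m − k`
  set j := l - κ - e' with hj
  set k := κ - (l - m - e') with hkdef
  have hkm : k ≤ m := by omega
  have hjk : j = m - k := by omega
  have hF1 := reduced_mul_le N l κ hκl j (by omega)
  have hF2 := levelLaw_up_le N l m hml k hkm
  -- identify the terms
  have eT : (N - 2 * κ).choose (2 * (l - κ) + 1 - 2 * e' + e') * (2 * (l - κ) + 1 - 2 * e' + e').choose e' *
      2 ^ (2 * (l - κ) + 1 - 2 * e') =
      (N - 2 * κ).choose (2 * j + 1 + (l - κ - j)) * (2 * j + 1 + (l - κ - j)).choose (l - κ - j) * 2 ^ (2 * j + 1) := by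
    rw [show 2 * (l - κ) + 1 - 2 * e' = 2 * j + 1 by omega, show l - κ - j = e' by omega]
  have eU : N.choose (2 * j + 1 + (l - j)) * (2 * j + 1 + (l - j)).choose (l - j) * 2 ^ (2 * j + 1) =
      N.choose (2 * (m - k) + 1 + (l - m + k)) * (2 * (m - k) + 1 + (l - m + k)).choose (l - m + k) * 2 ^ (2 * (m - k) + 1) := by
    rw [hjk, show l - (m - k) = l - m + k by omega]
  rw [eU] at hF1
  -- combine in `ℕ`: term · N(l) · den^k ≤ R(0) · N(l−m) · num^k
  have hden : (0 : ℝ) < 4 * ((l : ℝ) - m + 1) * ((N - l - m : ℕ) : ℝ) := by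
    have h1 : (0 : ℝ) < ((N - l - m : ℕ) : ℝ) := by exact_mod_cast (show 0 < N - l - m by omega)
    have h2 : (0 : ℝ) < (l : ℝ) - m + 1 := by
      have : (m : ℝ) ≤ l := by exact_mod_cast hml
      linarith
    exact mul_pos (mul_pos (by norm_num) h2) h1
  have hcomb : ((N - 2 * κ).choose (2 * j + 1 + (l - κ - j)) * (2 * j + 1 + (l - κ - j)).choose (l - κ - j) * 2 ^ (2 * j + 1) *
      (N.choose (1 + l) * (1 + l).choose l * 2 ^ 1) * (4 * (l - m + 1) * (N - l - m)) ^ k : ℕ) ≤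
      (N - 2 * κ).choose (1 + (l - κ)) * (1 + (l - κ)).choose (l - κ) * 2 ^ 1 *
        (N.choose (2 * m + 1 + (l - m)) * (2 * m + 1 + (l - m)).choose (l - m) * 2 ^ (2 * m + 1) *
        (2 * m * (2 * m + 1)) ^ k) :=
    calc _ ≤ (N - 2 * κ).choose (1 + (l - κ)) * (1 + (l - κ)).choose (l - κ) * 2 ^ 1 *
          (N.choose (2 * (m - k) + 1 + (l - m + k)) * (2 * (m - k) + 1 + (l - m + k)).choose (l - m + k) *
            2 ^ (2 * (m - k) + 1)) * (4 * (l - m + 1) * (N - l - m)) ^ k := Nat.mul_le_mul_right _ hF1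
      _ = (N - 2 * κ).choose (1 + (l - κ)) * (1 + (l - κ)).choose (l - κ) * 2 ^ 1 *
          (N.choose (2 * (m - k) + 1 + (l - m + k)) * (2 * (m - k) + 1 + (l - m + k)).choose (l - m + k) *
            2 ^ (2 * (m - k) + 1) * (4 * (l - m + 1) * (N - l - m)) ^ k) := by ring
      _ ≤ _ := Nat.mul_le_mul_left _ hF2
  have hcombR := (Nat.cast_le (α := ℝ)).2 hcomb
  push_cast [Nat.cast_sub hml] at hcombR
  have hdk : (0 : ℝ) < (4 * ((l : ℝ) - m + 1) * ((N - l - m : ℕ) : ℝ)) ^ k := pow_pos hden k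
  rw [eT, div_pow, div_mul_eq_mul_div, div_mul_eq_mul_div, le_div_iff₀ hdk]
  push_cast
  linarith [hcombR]

/-- **Tight dominance of the bi-mode coefficients.** For `κ ≤ l`, `m ≤ l`, `2l + 1 ≤ N` and
`ρ = 2m(2m+1)/(4(l−m+1)(N−l−m))`, the coefficient of brick 10 at the level with `l − m` inner edges satisfies
`|σ̃_{2κ}(l−m)| · T(N; 1, l) ≤ (1+ρ)^κ · T(N−2κ; 1, l−κ) · T(N; 2m+1, l−m)`, i.e. `|s_κ(2m+1)| ≤ (1+ρ)^κ · s_κ(1)` for the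
normalised level profiles (`T(N−2κ; 1, l−κ) = σ̃_{2κ}(l)` is the tight coefficient). [cite: Rothvoss2017, §2 (PDF p. 6)] -/
theorem bimodeCoeff_abs_mul_le (N l κ m : ℕ) (hκl : κ ≤ l) (hml : m ≤ l) (hlN : 2 * l + 1 ≤ N) :
    |∑ e' ∈ range (l - κ + 1), (if e' ≤ l - m then
        (-1 : ℝ) ^ (κ - (l - m - e')) * (κ.choose (l - m - e') : ℝ) *
          (((N - 2 * κ).choose (2 * (l - κ) + 1 - 2 * e' + e') *
              (2 * (l - κ) + 1 - 2 * e' + e').choose e' * 2 ^ (2 * (l - κ) + 1 - 2 * e') : ℕ) : ℝ)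
        else 0)| * ((N.choose (1 + l) * (1 + l).choose l * 2 ^ 1 : ℕ) : ℝ) ≤
      (1 + (2 * m * (2 * m + 1) : ℝ) / (4 * (l - m + 1) * ((N - l - m : ℕ) : ℝ))) ^ κ *
        (((N - 2 * κ).choose (1 + (l - κ)) * (1 + (l - κ)).choose (l - κ) * 2 ^ 1 : ℕ) : ℝ) *
        ((N.choose (2 * m + 1 + (l - m)) * (2 * m + 1 + (l - m)).choose (l - m) * 2 ^ (2 * m + 1) : ℕ) : ℝ) := by
  set ρ : ℝ := (2 * m * (2 * m + 1) : ℝ) / (4 * (l - m + 1) * ((N - l - m : ℕ) : ℝ)) with hρ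
  set R0 : ℝ := (((N - 2 * κ).choose (1 + (l - κ)) * (1 + (l - κ)).choose (l - κ) * 2 ^ 1 : ℕ) : ℝ) with hR0
  set Um : ℝ := ((N.choose (2 * m + 1 + (l - m)) * (2 * m + 1 + (l - m)).choose (l - m) * 2 ^ (2 * m + 1) : ℕ) : ℝ) with hUm
  set U0 : ℝ := ((N.choose (1 + l) * (1 + l).choose l * 2 ^ 1 : ℕ) : ℝ) with hU0
  have hρ0 : 0 ≤ ρ := by
    rw [hρ]
    have : (m : ℝ) ≤ l := by exact_mod_cast hml
    have : (0 : ℝ) ≤ (l : ℝ) - m + 1 := by linarith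
    positivity
  have hU0nn : 0 ≤ U0 := by rw [hU0]; positivity
  -- triangle inequality, term by term
  refine le_trans (mul_le_mul_of_nonneg_right (abs_sum_le_sum_abs _ _) hU0nn) ?_
  rw [sum_mul]
  have hterm : ∀ e' ∈ range (l - κ + 1), |(if e' ≤ l - m then
        (-1 : ℝ) ^ (κ - (l - m - e')) * (κ.choose (l - m - e') : ℝ) *
          (((N - 2 * κ).choose (2 * (l - κ) + 1 - 2 * e' + e') *
              (2 * (l - κ) + 1 - 2 * e' + e').choose e' * 2 ^ (2 * (l - κ) + 1 - 2 * e') : ℕ) : ℝ)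
        else 0)| * U0 ≤
      (if e' ≤ l - m then (κ.choose (l - m - e') : ℝ) * ρ ^ (κ - (l - m - e')) else 0) * (R0 * Um) := by
    intro e' he'
    have he'l : e' ≤ l - κ := by have := mem_range.1 he'; omega
    by_cases he'e : e' ≤ l - m
    · rw [if_pos he'e, if_pos he'e]
      by_cases hk : l - m - e' ≤ κ
      · rw [abs_mul, abs_mul, abs_pow, abs_neg, abs_one, one_pow, one_mul, Nat.abs_cast, Nat.abs_cast]
        have h := levelLaw_term_le N l κ m e' hκl hml hlN he'l he'e hk
        rw [← hρ, ← hR0, ← hUm, ← hU0] at h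
        calc (κ.choose (l - m - e') : ℝ) * (((N - 2 * κ).choose (2 * (l - κ) + 1 - 2 * e' + e') *
              (2 * (l - κ) + 1 - 2 * e' + e').choose e' * 2 ^ (2 * (l - κ) + 1 - 2 * e') : ℕ) : ℝ) * U0
            = (κ.choose (l - m - e') : ℝ) * ((((N - 2 * κ).choose (2 * (l - κ) + 1 - 2 * e' + e') *
              (2 * (l - κ) + 1 - 2 * e' + e').choose e' * 2 ^ (2 * (l - κ) + 1 - 2 * e') : ℕ) : ℝ) * U0) := by ring
          _ ≤ (κ.choose (l - m - e') : ℝ) * (ρ ^ (κ - (l - m - e')) * R0 * Um) :=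
              mul_le_mul_of_nonneg_left h (Nat.cast_nonneg _)
          _ = _ := by ring
      · rw [Nat.choose_eq_zero_of_lt (by omega : κ < l - m - e')]; simp
    · rw [if_neg he'e, if_neg he'e]; simp
  refine le_trans (sum_le_sum hterm) ?_
  rw [← sum_mul]
  have hRU : 0 ≤ R0 * Um := by rw [hR0, hUm]; positivity
  rw [show (1 + ρ) ^ κ * R0 * Um = (1 + ρ) ^ κ * (R0 * Um) by ring]
  refine mul_le_mul_of_nonneg_right ?_ hRU
  -- `Σ_{e' ≤ min(l−κ, l−m)} C(κ, (l−m)−e') ρ^{κ−((l−m)−e')} ≤ Σ_{d ≤ κ} C(κ, d) ρ^{κ−d} = (1+ρ)^κ`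
  have hnn : ∀ d : ℕ, 0 ≤ (κ.choose d : ℝ) * ρ ^ (κ - d) := fun d => by positivity
  calc ∑ e' ∈ range (l - κ + 1), (if e' ≤ l - m then (κ.choose (l - m - e') : ℝ) * ρ ^ (κ - (l - m - e')) else 0)
      ≤ ∑ e' ∈ range (l - m + 1), (κ.choose (l - m - e') : ℝ) * ρ ^ (κ - (l - m - e')) := by
        rw [← sum_filter]
        refine sum_le_sum_of_subset_of_nonneg (fun e' he' => ?_) (fun d _ _ => hnn _)
        rw [mem_filter, mem_range] at he'
        exact mem_range.2 (by omega)
    _ = ∑ e' ∈ range (l - m + 1), (fun d => (κ.choose d : ℝ) * ρ ^ (κ - d)) (l - m + 1 - 1 - e') :=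
        sum_congr rfl fun e' _ => by simp only [show l - m + 1 - 1 - e' = l - m - e' by omega]
    _ = ∑ d ∈ range (l - m + 1), (κ.choose d : ℝ) * ρ ^ (κ - d) :=
        sum_range_reflect (fun d => (κ.choose d : ℝ) * ρ ^ (κ - d)) (l - m + 1)
    _ ≤ ∑ d ∈ range (l - m + κ + 1), (κ.choose d : ℝ) * ρ ^ (κ - d) :=
        sum_le_sum_of_subset_of_nonneg (range_subset_range.2 (by omega)) (fun d _ _ => hnn _)
    _ = ∑ d ∈ range (κ + 1), (κ.choose d : ℝ) * ρ ^ (κ - d) := by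
        symm
        refine sum_subset (range_subset_range.2 (by omega)) fun d hd hd' => ?_
        rw [mem_range] at hd hd'
        rw [Nat.choose_eq_zero_of_lt (by omega : κ < d)]; simp
    _ = (1 + ρ) ^ κ := by
        rw [add_pow]
        refine sum_congr rfl fun d _ => ?_
        rw [one_pow, one_mul, mul_comm]

/-- **Tight dominance, squared form** (the input of the spectral conversion, brick 12): under the same hypotheses,
`σ̃_{2κ}(l−m)² · T(N; 1, l)² ≤ (1+ρ)^{2κ} · T(N−2κ; 1, l−κ)² · T(N; 2m+1, l−m)²`. [cite: Rothvoss2017, §2 (PDF p. 6)] -/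
theorem bimodeCoeff_sq_mul_le (N l κ m : ℕ) (hκl : κ ≤ l) (hml : m ≤ l) (hlN : 2 * l + 1 ≤ N) :
    (∑ e' ∈ range (l - κ + 1), (if e' ≤ l - m then
        (-1 : ℝ) ^ (κ - (l - m - e')) * (κ.choose (l - m - e') : ℝ) *
          (((N - 2 * κ).choose (2 * (l - κ) + 1 - 2 * e' + e') *
              (2 * (l - κ) + 1 - 2 * e' + e').choose e' * 2 ^ (2 * (l - κ) + 1 - 2 * e') : ℕ) : ℝ)
        else 0)) ^ 2 * ((N.choose (1 + l) * (1 + l).choose l * 2 ^ 1 : ℕ) : ℝ) ^ 2 ≤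
      ((1 + (2 * m * (2 * m + 1) : ℝ) / (4 * (l - m + 1) * ((N - l - m : ℕ) : ℝ))) ^ κ) ^ 2 *
        (((N - 2 * κ).choose (1 + (l - κ)) * (1 + (l - κ)).choose (l - κ) * 2 ^ 1 : ℕ) : ℝ) ^ 2 *
        ((N.choose (2 * m + 1 + (l - m)) * (2 * m + 1 + (l - m)).choose (l - m) * 2 ^ (2 * m + 1) : ℕ) : ℝ) ^ 2 := by
  have h := bimodeCoeff_abs_mul_le N l κ m hκl hml hlN
  have hnn : 0 ≤ |∑ e' ∈ range (l - κ + 1), (if e' ≤ l - m then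
        (-1 : ℝ) ^ (κ - (l - m - e')) * (κ.choose (l - m - e') : ℝ) *
          (((N - 2 * κ).choose (2 * (l - κ) + 1 - 2 * e' + e') *
              (2 * (l - κ) + 1 - 2 * e' + e').choose e' * 2 ^ (2 * (l - κ) + 1 - 2 * e') : ℕ) : ℝ)
        else 0)| * ((N.choose (1 + l) * (1 + l).choose l * 2 ^ 1 : ℕ) : ℝ) :=
    mul_nonneg (abs_nonneg _) (by positivity)
  have h2 := mul_le_mul h h hnn (le_trans hnn h)
  rw [← sq, mul_pow, sq_abs] at h2
  calc _ ≤ _ := h2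
    _ = _ := by ring

end Summit.PneNP.PneNP.Theorems.ChebyshevTracialDesignLevelDominance
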